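import Summits.QuantumAdvantage.QuantumAdvantage.Theorems.RingFrameRingToElimStubs
import Summits.QuantumAdvantage.AdviceFreeQNC0.CrossFreeWindowPolylog
import HarnessLib

/-!
# Route RingFrame, crux α `RingToElim` (stmt-QuantumAdvantage-19119): α IS ITS CROSS-READING
# CASE — hardness for strategies that read ACROSS every polylog window gives `RingToElim`

The cross-free window theorem (`ringWinU_crossFree_le`, `AdviceFreeQNC0/CrossFreeWindowPolylog.lean`):
there is `θ₂ < 1` such that for every `C` and all large `n`, a walk strategy of degree
`≤ (log₂ n)^C` admitting a window of three blocks `X ++ H ++ Z` of `ℓ = (log₂ n)^{2C+1}` input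
bits each, such that no selector strictly inside `X` reads a bit of `Z` and no selector strictly
inside `Z` reads a bit of `X`, wins the ring game in walk coordinates on at most `θ₂·2ⁿ` inputs —
whatever the selectors do otherwise (dense bets, reading their own block, the middle block and
everything outside).  Hence the crux `RingHardU` follows from its restriction to CROSS-READING
strategies: inside EVERY such window (`p + 3ℓ ≤ n`) some selector located strictly inside `X`
distinguishes two inputs that differ only on `Z`, or some selector strictly inside `Z`
distinguishes two inputs that differ only on `X` — a selector reading a bit at distance `≥ ℓ`
across the middle block, everywhere along the input:

* `ringHardU_of_crossReadingHard` — cross-reading hardness (stated inline) `→ RingHardU`;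
* `ringHard_two_of_crossReadingHard`, `ringToElim_of_crossReadingHard` — then `RingHard 2`
  (`stub_transport`) and the crux `RingToElim` BY NAME.

This refines `ringToElim_of_denseHard` and `ringToElim_of_sightedHard`; in particular every
strategy given by local rules of polylog range is beaten unconditionally
(`ringWinU_localRules_le`).  The cell's statement (prover qn-prover-3); not in print.
WHAT THIS IS NOT: cross-reading hardness is NOT proved (it is α proper; low-degree selectors can
read far bits); conditional results credit nothing; no separation.
-/

-- the sub-problem namespace `Summit.QuantumAdvantage.QuantumAdvantage` repeats the summit name by design (D-0017)
set_option linter.dupNamespace false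

noncomputable section

namespace Summit.QuantumAdvantage.QuantumAdvantage.Theorems

open Finset Summit.QuantumAdvantage.AdviceFreeQNC0 RingToElim
open Literature.Computability.MetaComplexity Literature.Computability.MetaComplexity.Smolensky

/-- **α is its cross-reading case.**  If there is `θ < 1` such that for every `C` and all large
`n` every CROSS-READING walk strategy of degree `≤ (log₂ n)^C` — in every window of three blocks
of `ℓ = (log₂ n)^{2C+1}` bits some selector strictly inside the first block reads the third or
vice versa — wins the ring game at charge `n + 2` on at most `θ·2ⁿ` inputs, then `RingHardU`
(all strategies): a strategy that is not cross-reading has a cross-free window and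
`ringWinU_crossFree_le` bounds it.  (Cell statement; conditional on the hypothesis.) -/
theorem ringHardU_of_crossReadingHard
    (h : ∃ θ : ℝ, θ < 1 ∧ ∀ C : ℕ, ∃ n₀ : ℕ, ∀ n ≥ n₀, ∀ y : Fin (n + 1) → (Fin n → Bool) → Bool,
      (∀ g, HasDeg (y g) ((Nat.log 2 n) ^ C)) →
      (∀ p : ℕ, p + 3 * (Nat.log 2 n) ^ (2 * C + 1) ≤ n →
        (∃ g : Fin (n + 1), p < g.val ∧ g.val < p + (Nat.log 2 n) ^ (2 * C + 1) ∧
          ∃ u u' : Fin n → Bool,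
            (∀ i : Fin n, ¬ (p + 2 * (Nat.log 2 n) ^ (2 * C + 1) ≤ i.val ∧
              i.val < p + 3 * (Nat.log 2 n) ^ (2 * C + 1)) → u i = u' i) ∧ y g u ≠ y g u') ∨
        (∃ g : Fin (n + 1), p + 2 * (Nat.log 2 n) ^ (2 * C + 1) < g.val ∧
          g.val < p + 3 * (Nat.log 2 n) ^ (2 * C + 1) ∧
          ∃ u u' : Fin n → Bool,
            (∀ i : Fin n, ¬ (p ≤ i.val ∧ i.val < p + (Nat.log 2 n) ^ (2 * C + 1)) → u i = u' i) ∧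
            y g u ≠ y g u')) →
        ((univ.filter fun u : Fin n → Bool => ringWinU (n + 2) y u = true).card : ℝ) ≤
          θ * (2 : ℝ) ^ n) :
    RingHardU := by
  obtain ⟨θ₁, hθ₁, h₁⟩ := h
  obtain ⟨θ₂, hθ₂, h₂⟩ := ringWinU_crossFree_le
  refine ⟨max θ₁ θ₂, max_lt hθ₁ hθ₂, fun C => ?_⟩
  obtain ⟨n₁, hn₁⟩ := h₁ C
  obtain ⟨n₂, hn₂⟩ := h₂ C
  refine ⟨max n₁ n₂, fun n hn y hdeg => ?_⟩
  have hn₁n : n₁ ≤ n := le_trans (le_max_left _ _) hn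
  have hn₂n : n₂ ≤ n := le_trans (le_max_right _ _) hn
  have hpow : (0 : ℝ) ≤ (2 : ℝ) ^ n := by positivity
  set ℓ := (Nat.log 2 n) ^ (2 * C + 1) with hℓ
  by_cases hcross : ∀ p : ℕ, p + 3 * ℓ ≤ n →
      (∃ g : Fin (n + 1), p < g.val ∧ g.val < p + ℓ ∧ ∃ u u' : Fin n → Bool,
          (∀ i : Fin n, ¬ (p + 2 * ℓ ≤ i.val ∧ i.val < p + 3 * ℓ) → u i = u' i) ∧ y g u ≠ y g u') ∨
      (∃ g : Fin (n + 1), p + 2 * ℓ < g.val ∧ g.val < p + 3 * ℓ ∧ ∃ u u' : Fin n → Bool,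
          (∀ i : Fin n, ¬ (p ≤ i.val ∧ i.val < p + ℓ) → u i = u' i) ∧ y g u ≠ y g u')
  · -- cross-reading: the hypothesis
    calc ((univ.filter fun u : Fin n → Bool => ringWinU (n + 2) y u = true).card : ℝ)
        ≤ θ₁ * (2 : ℝ) ^ n := hn₁ n hn₁n y hdeg hcross
      _ ≤ max θ₁ θ₂ * (2 : ℝ) ^ n := mul_le_mul_of_nonneg_right (le_max_left _ _) hpow
  · -- not cross-reading: a cross-free window `[p, p+ℓ) ++ [p+ℓ, p+2ℓ) ++ [p+2ℓ, p+3ℓ)`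
    push Not at hcross
    obtain ⟨p, hp, hX, hZ⟩ := hcross
    have hX' : ∀ g : Fin (n + 1), p < g.val → g.val < p + ℓ → ∀ u u' : Fin n → Bool,
        (∀ i : Fin n, ¬ (p + (ℓ + ℓ) ≤ i.val ∧ i.val < p + (ℓ + ℓ + ℓ)) → u i = u' i) →
        y g u = y g u' := by
      intro g hg1 hg2 u u' huu'
      refine hX g hg1 hg2 u u' fun i hi => huu' i ?_
      omega
    have hZ' : ∀ g : Fin (n + 1), p + (ℓ + ℓ) < g.val → g.val < p + (ℓ + ℓ + ℓ) →
        ∀ u u' : Fin n → Bool, (∀ i : Fin n, ¬ (p ≤ i.val ∧ i.val < p + ℓ) → u i = u' i) →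
        y g u = y g u' := by
      intro g hg1 hg2 u u' huu'
      exact hZ g (by omega) (by omega) u u' fun i hi => huu' i (by omega)
    calc ((univ.filter fun u : Fin n → Bool => ringWinU (n + 2) y u = true).card : ℝ)
        ≤ θ₂ * (2 : ℝ) ^ n := hn₂ n hn₂n p ℓ ℓ ℓ (by omega) le_rfl le_rfl (n + 2) y hdeg hX' hZ'
      _ ≤ max θ₁ θ₂ * (2 : ℝ) ^ n := mul_le_mul_of_nonneg_right (le_max_right _ _) hpow

/-- **Cross-reading hardness gives the rung statement `RingHard 2`** (through `stub_transport`). -/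
theorem ringHard_two_of_crossReadingHard
    (h : ∃ θ : ℝ, θ < 1 ∧ ∀ C : ℕ, ∃ n₀ : ℕ, ∀ n ≥ n₀, ∀ y : Fin (n + 1) → (Fin n → Bool) → Bool,
      (∀ g, HasDeg (y g) ((Nat.log 2 n) ^ C)) →
      (∀ p : ℕ, p + 3 * (Nat.log 2 n) ^ (2 * C + 1) ≤ n →
        (∃ g : Fin (n + 1), p < g.val ∧ g.val < p + (Nat.log 2 n) ^ (2 * C + 1) ∧
          ∃ u u' : Fin n → Bool,
            (∀ i : Fin n, ¬ (p + 2 * (Nat.log 2 n) ^ (2 * C + 1) ≤ i.val ∧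
              i.val < p + 3 * (Nat.log 2 n) ^ (2 * C + 1)) → u i = u' i) ∧ y g u ≠ y g u') ∨
        (∃ g : Fin (n + 1), p + 2 * (Nat.log 2 n) ^ (2 * C + 1) < g.val ∧
          g.val < p + 3 * (Nat.log 2 n) ^ (2 * C + 1) ∧
          ∃ u u' : Fin n → Bool,
            (∀ i : Fin n, ¬ (p ≤ i.val ∧ i.val < p + (Nat.log 2 n) ^ (2 * C + 1)) → u i = u' i) ∧
            y g u ≠ y g u')) →
        ((univ.filter fun u : Fin n → Bool => ringWinU (n + 2) y u = true).card : ℝ) ≤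
          θ * (2 : ℝ) ^ n) :
    Summit.QuantumAdvantage.AdviceFreeQNC0.RingHard 2 :=
  stub_transport (ringHardU_of_crossReadingHard h)

/-- **Cross-reading hardness gives the crux α `RingToElim` by name** (its antecedent `ElimHard`
is not even needed: it is a theorem, `elimHard_holds`). -/
theorem ringToElim_of_crossReadingHard
    (h : ∃ θ : ℝ, θ < 1 ∧ ∀ C : ℕ, ∃ n₀ : ℕ, ∀ n ≥ n₀, ∀ y : Fin (n + 1) → (Fin n → Bool) → Bool,
      (∀ g, HasDeg (y g) ((Nat.log 2 n) ^ C)) →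
      (∀ p : ℕ, p + 3 * (Nat.log 2 n) ^ (2 * C + 1) ≤ n →
        (∃ g : Fin (n + 1), p < g.val ∧ g.val < p + (Nat.log 2 n) ^ (2 * C + 1) ∧
          ∃ u u' : Fin n → Bool,
            (∀ i : Fin n, ¬ (p + 2 * (Nat.log 2 n) ^ (2 * C + 1) ≤ i.val ∧
              i.val < p + 3 * (Nat.log 2 n) ^ (2 * C + 1)) → u i = u' i) ∧ y g u ≠ y g u') ∨
        (∃ g : Fin (n + 1), p + 2 * (Nat.log 2 n) ^ (2 * C + 1) < g.val ∧
          g.val < p + 3 * (Nat.log 2 n) ^ (2 * C + 1) ∧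
          ∃ u u' : Fin n → Bool,
            (∀ i : Fin n, ¬ (p ≤ i.val ∧ i.val < p + (Nat.log 2 n) ^ (2 * C + 1)) → u i = u' i) ∧
            y g u ≠ y g u')) →
        ((univ.filter fun u : Fin n → Bool => ringWinU (n + 2) y u = true).card : ℝ) ≤
          θ * (2 : ℝ) ^ n) :
    Summit.QuantumAdvantage.QuantumAdvantage.Theses.RingFrame.RingToElim :=
  fun _ => ringHard_two_of_crossReadingHard h

end Summit.QuantumAdvantage.QuantumAdvantage.Theorems
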